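import Literature.NumberTheory.GaloisRepresentations.InducedGaloisRep
import Literature.NumberTheory.GaloisRepresentations.FramedRepBlockSum
import HarnessLib

/-!
# Mackey's irreducibility criterion for `Ind_{Γ_F}^{Γ_K} ψ`, `ψ` irreducible of any rank (matrix form)
(helper for the AUTOMORPHIC-INDUCTION ASCENT of crux stmt-Langlands-14329 `IrreducibleOffSector`,
line `Sketch`, lead c4; pure Galois-side algebra)

For `F/K` finite Galois of degree `d` (characteristic `0`), a field `A` and a continuous
`ψ : Γ_F → GL_m(A)` which is IRREDUCIBLE and whose conjugates `ψ^{r_i⁻¹}` by the chosen coset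
representatives are pairwise NON-CONJUGATE (`FramedRep.conj`), the induced representation
`Ind(ψ) = ψ.induce K hd : Γ_K → GL_{d m}(A)` is irreducible (`isIrreducible_induce_of_not_conj`).
Elementary proof (no semisimplicity): on `res(Γ_F)` the matrix `Ind(ψ)(res σ)` is block diagonal
with blocks `ψ^{r_i⁻¹}(σ)` (`induce_absGaloisRestrict_coe`), so the block projections
`p_i : A^{dm} → A^m` are `Γ_F`-equivariant; a MINIMAL non-zero `Γ_F`-stable subspace `U` of a
`Γ_K`-stable `W ≠ 0` maps under each `p_i` either to `0` or isomorphically onto `A^m` (kernels are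
stable and `ψ^{r_i⁻¹}` is irreducible); two such isomorphisms `p_i|_U, p_j|_U` would conjugate
`ψ^{r_i⁻¹}` into `ψ^{r_j⁻¹}`, so exactly one `p_i` is non-zero on `U` and `U` is the whole block
`V_i`; finally `Ind(ψ)(r_k r_i⁻¹) V_i = V_k` (monomial block matrices), so `W ⊇ ⊕_k V_k`.
Serre, *Linear representations of finite groups*, §7.4 Cor. (Mackey). [SerreLinearRepresentations1977]
-/

noncomputable section

set_option linter.dupNamespace false

open scoped Matrix
open Field
open Literature.NumberTheory.GaloisRepresentations

namespace Summit.Langlands.Langlands.Theorems.IrreducibleOffSector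

section Blocks

variable (K : Type) {F : Type} [Field K] [Field F] [Algebra K F] [CharZero K]
  [FiniteDimensional K F] [IsGalois K F] [CharZero F]
  {A : Type*} [Field A] [TopologicalSpace A] {d m : ℕ}

/-- **Block-diagonal action of `res(Γ_F)` on `Ind(ψ)`, coordinatewise**: for `σ ∈ Γ_F`, the
`(i, a)`-coordinate of `Ind(ψ)(res σ) · w` is the `a`-coordinate of `ψ^{r_i⁻¹}(σ) · w_i`, `w_i` the
`i`-th block of `w` (Serre §7.3 Prop. 22: `Res Ind ψ = ⊕_i ψ^{r_i⁻¹}`).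
[cite: SerreLinearRepresentations1977, §7.3 Prop. 22] -/
theorem induce_absGaloisRestrict_mulVec_block (hd : Module.finrank K F = d)
    (ψ : FramedGaloisRep F A m) (σ : absoluteGaloisGroup F) (w : Fin (d * m) → A) (i : Fin d)
    (a : Fin m) :
    (((ψ.induce K hd (absGaloisRestrict K F σ) : GL (Fin (d * m)) A) :
        Matrix (Fin (d * m)) (Fin (d * m)) A) *ᵥ w) (finProdFinEquiv (i, a)) =
      (((ψ.outerConj (absGaloisCosetRep K F hd i)⁻¹ σ : GL (Fin m) A) : Matrix (Fin m) (Fin m) A) *ᵥ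
        fun b => w (finProdFinEquiv (i, b))) a := by
  classical
  rw [FramedGaloisRep.induce_absGaloisRestrict_coe K hd ψ σ, Matrix.mulVec, Matrix.mulVec,
    dotProduct, dotProduct]
  -- reindex the sum over `Fin (d * m)` as a sum over `Fin d × Fin m`
  rw [← finProdFinEquiv.sum_comp, Fintype.sum_prod_type]
  rw [Finset.sum_eq_single i]
  · refine Finset.sum_congr rfl fun b _ => ?_
    rw [Matrix.reindex_apply, Matrix.submatrix_apply, Equiv.symm_apply_apply,
      Equiv.symm_apply_apply, Matrix.comp_apply, Matrix.diagonal_apply_eq]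
  · intro j _ hji
    refine Finset.sum_eq_zero fun b _ => ?_
    rw [Matrix.reindex_apply, Matrix.submatrix_apply, Equiv.symm_apply_apply,
      Equiv.symm_apply_apply, Matrix.comp_apply, Matrix.diagonal_apply_ne _ (Ne.symm hji),
      Matrix.zero_apply, zero_mul]
  · intro hi
    exact absurd (Finset.mem_univ i) hi

omit [IsGalois K F] [CharZero F] in
/-- **The block matrices of `Ind(ψ)` are monomial**: `Ind(ψ)(r_k r_i⁻¹)` maps the `i`-th block
copy of `v ∈ A^m` to its `k`-th block copy. [cite: SerreLinearRepresentations1977, §3.3 Thm. 12 (proof)] -/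
theorem induce_mulVec_blockVec (hd : Module.finrank K F = d) (ψ : FramedGaloisRep F A m)
    (i k : Fin d) (v : Fin m → A) :
    ((ψ.induce K hd (absGaloisCosetRep K F hd k * (absGaloisCosetRep K F hd i)⁻¹) :
        GL (Fin (d * m)) A) : Matrix (Fin (d * m)) (Fin (d * m)) A) *ᵥ
        (fun x => if (finProdFinEquiv.symm x).1 = i then v (finProdFinEquiv.symm x).2 else 0) =
      fun x => if (finProdFinEquiv.symm x).1 = k then v (finProdFinEquiv.symm x).2 else 0 := by
  classical
  funext x
  rw [Matrix.mulVec, dotProduct, ← finProdFinEquiv.sum_comp, Fintype.sum_prod_type,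
    Finset.sum_eq_single i]
  · -- the `i`-th block column
    simp only [Equiv.symm_apply_apply, if_true]
    obtain ⟨⟨j, a⟩, rfl⟩ := finProdFinEquiv.surjective x
    simp only [Equiv.symm_apply_apply]
    have hentry : ∀ b : Fin m,
        ((ψ.induce K hd (absGaloisCosetRep K F hd k * (absGaloisCosetRep K F hd i)⁻¹) :
            GL (Fin (d * m)) A) : Matrix (Fin (d * m)) (Fin (d * m)) A)
            (finProdFinEquiv (j, a)) (finProdFinEquiv (i, b)) =
          dotExtend (absGaloisRestrict K F).toMonoidHom (FramedRep.toMatrixHom ψ)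
            ((absGaloisCosetRep K F hd j)⁻¹ * 1 * absGaloisCosetRep K F hd k) a b := by
      intro b
      rw [FramedGaloisRep.induce_apply_coe_apply, Equiv.symm_apply_apply, Equiv.symm_apply_apply]
      group
    simp_rw [hentry]
    by_cases hjk : j = k
    · subst hjk
      rw [if_pos rfl, mul_one, inv_mul_cancel, ← (absGaloisRestrict K F).toMonoidHom.map_one,
        dotExtend_apply_map (absGaloisRestrict_injective K F)]
      simp only [map_one]
      rw [← dotProduct, ← Matrix.mulVec, Matrix.one_mulVec]
    · rw [if_neg hjk, dotExtend_of_not_mem]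
      · simp
      · intro hmem
        apply hjk
        exact (absGaloisCosetRep_bijective K F hd).1
          ((inv_mul_mul_mem_range_iff _ _ 1 j k).1 hmem |>.trans (by rw [one_mul]))
  · intro j _ hji
    refine Finset.sum_eq_zero fun b _ => ?_
    simp only [Equiv.symm_apply_apply, if_neg hji, mul_zero]
  · intro hi
    exact absurd (Finset.mem_univ i) hi

end Blocks

section Main

/-- **Mackey's criterion: `Ind_{Γ_F}^{Γ_K} ψ` is irreducible for `ψ` irreducible with pairwise
non-conjugate conjugates.**  Let `F/K` be finite Galois of degree `d` (characteristic `0`), `A` a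
field, `ψ : Γ_F → GL_m(A)` continuous and IRREDUCIBLE, such that for `i ≠ j` no `P ∈ GL_m(A)`
conjugates `ψ^{r_i⁻¹}` into `ψ^{r_j⁻¹}` (`r_i` the chosen coset representatives
`absGaloisCosetRep`).  Then `Ind(ψ) = ψ.induce K hd` is irreducible.  Proof: module docstring
(block projections are `Γ_F`-equivariant; a minimal non-zero `Γ_F`-stable subspace of a stable
`W ≠ 0` is a full block `V_i`, by irreducibility of the `ψ^{r_i⁻¹}` and their non-conjugacy; the
monomial block matrices move `V_i` to every `V_k`).  Serre, *Linear representations of finite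
groups*, §7.4 Cor. [cite: SerreLinearRepresentations1977, §7.3 Prop. 22] -/
theorem isIrreducible_induce_of_not_conj (K : Type) {F : Type} [Field K] [Field F]
    [Algebra K F] [CharZero K] [FiniteDimensional K F] [IsGalois K F] [CharZero F]
    {A : Type*} [Field A] [TopologicalSpace A] [IsTopologicalRing A] {d m : ℕ}
    (hd : Module.finrank K F = d) (ψ : FramedGaloisRep F A m)
    (hirr : ψ.toGaloisRep.IsIrreducible)
    (hreg : ∀ i j : Fin d, i ≠ j → ∀ P : GL (Fin m) A,
      ψ.outerConj (absGaloisCosetRep K F hd j)⁻¹ ≠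
        FramedRep.conj P (ψ.outerConj (absGaloisCosetRep K F hd i)⁻¹)) :
    (ψ.induce K hd).toGaloisRep.IsIrreducible := by
  classical
  -- notation: matrices of `Ind ψ`, the conjugates, block projections and embeddings
  let M : absoluteGaloisGroup K → Matrix (Fin (d * m)) (Fin (d * m)) A := fun g =>
    ((ψ.induce K hd g : GL (Fin (d * m)) A) : Matrix (Fin (d * m)) (Fin (d * m)) A)
  let C : Fin d → absoluteGaloisGroup F → Matrix (Fin m) (Fin m) A := fun i σ =>
    ((ψ.outerConj (absGaloisCosetRep K F hd i)⁻¹ σ : GL (Fin m) A) : Matrix (Fin m) (Fin m) A)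
  let proj : Fin d → (Fin (d * m) → A) →ₗ[A] (Fin m → A) := fun i =>
    LinearMap.funLeft A A fun a => finProdFinEquiv (i, a)
  let emb : Fin d → (Fin m → A) → (Fin (d * m) → A) := fun i v x =>
    if (finProdFinEquiv.symm x).1 = i then v (finProdFinEquiv.symm x).2 else 0
  have hproj : ∀ i w a, proj i w a = w (finProdFinEquiv (i, a)) := fun i w a => rfl
  have hact : ∀ (g : absoluteGaloisGroup K) (v : Fin (d * m) → A),
      (ψ.induce K hd).toGaloisRep.toRepresentation g v = M g *ᵥ v := fun g v => rfl
  -- block calculus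
  have hemb : ∀ i v j a, emb i v (finProdFinEquiv (j, a)) = if j = i then v a else 0 := by
    intro i v j a
    show (if (finProdFinEquiv.symm (finProdFinEquiv (j, a))).1 = i then
      v (finProdFinEquiv.symm (finProdFinEquiv (j, a))).2 else 0) = _
    rw [Equiv.symm_apply_apply]
  have hpe : ∀ i v, proj i (emb i v) = v := fun i v => by
    funext a; rw [hproj, hemb, if_pos rfl]
  have hrecon : ∀ (i) (u : Fin (d * m) → A), (∀ j, j ≠ i → proj j u = 0) → u = emb i (proj i u) := by
    intro i u hu
    funext x
    obtain ⟨⟨j, a⟩, rfl⟩ := finProdFinEquiv.surjective x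
    rw [hemb]
    by_cases hji : j = i
    · subst hji; rw [if_pos rfl, hproj]
    · have := congrFun (hu j hji) a
      rw [hproj] at this
      rw [if_neg hji, this, Pi.zero_apply]
  have hsum : ∀ w : Fin (d * m) → A, w = ∑ k, emb k (proj k w) := by
    intro w
    funext x
    obtain ⟨⟨j, a⟩, rfl⟩ := finProdFinEquiv.surjective x
    rw [Finset.sum_apply]
    simp only [hemb, hproj]
    rw [Finset.sum_ite_eq Finset.univ j, if_pos (Finset.mem_univ _)]
  -- `Γ_F`-equivariance of the projections, and the translations between blocks
  have hequiv : ∀ (i) (σ : absoluteGaloisGroup F) (w : Fin (d * m) → A),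
      proj i (M (absGaloisRestrict K F σ) *ᵥ w) = C i σ *ᵥ proj i w := by
    intro i σ w
    funext a
    rw [hproj]
    exact induce_absGaloisRestrict_mulVec_block K hd ψ σ w i a
  have htrans : ∀ (i k) (v : Fin m → A),
      M (absGaloisCosetRep K F hd k * (absGaloisCosetRep K F hd i)⁻¹) *ᵥ emb i v = emb k v :=
    fun i k v => induce_mulVec_blockVec K hd ψ i k v
  -- irreducibility of the conjugates: a `C i`-stable non-zero subspace of `A^m` is everything
  have hCirr : ∀ (i) (I : Submodule A (Fin m → A)),
      (∀ σ, ∀ v ∈ I, C i σ *ᵥ v ∈ I) → I ≠ ⊥ → I = ⊤ := by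
    intro i I hI hI0
    let I' : Subrepresentation ψ.toGaloisRep.toRepresentation :=
      ⟨I, fun σ' v hv => by
        obtain ⟨σ, rfl⟩ := (absGaloisOuterConj_bijective K F (absGaloisCosetRep K F hd i)⁻¹).2 σ'
        exact hI σ v hv⟩
    haveI := hirr
    rcases IsSimpleOrder.eq_bot_or_eq_top I' with h | h
    · exact absurd (congrArg Subrepresentation.toSubmodule h) hI0
    · exact congrArg Subrepresentation.toSubmodule h
  -- a non-zero vector of `A^m` (so `A^{dm} ≠ 0` and the lattice of subrepresentations is non-trivial)
  have hbtψ : (⊥ : Subrepresentation ψ.toGaloisRep.toRepresentation) ≠ ⊤ := by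
    haveI := hirr; exact bot_ne_top
  obtain ⟨v₀, -, hv₀⟩ : ∃ v₀ ∈ (⊤ : Submodule A (Fin m → A)), v₀ ≠ 0 := by
    rw [← Submodule.ne_bot_iff]
    intro h
    have h' : (⊥ : Subrepresentation ψ.toGaloisRep.toRepresentation).toSubmodule =
        (⊤ : Subrepresentation ψ.toGaloisRep.toRepresentation).toSubmodule := h.symm
    exact hbtψ (Subrepresentation.toSubmodule_injective h')
  have hdpos : 0 < d := hd ▸ Module.finrank_pos
  haveI : Nontrivial (Subrepresentation (ψ.induce K hd).toGaloisRep.toRepresentation) := by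
    refine ⟨⟨⊥, ⊤, fun h => hv₀ ?_⟩⟩
    have hmem : emb ⟨0, hdpos⟩ v₀ ∈
        (⊥ : Subrepresentation (ψ.induce K hd).toGaloisRep.toRepresentation).toSubmodule := by
      rw [h]; trivial
    have hzero : emb ⟨0, hdpos⟩ v₀ = 0 := hmem
    rw [← hpe ⟨0, hdpos⟩ v₀, hzero, map_zero]
  -- main argument
  refine ⟨fun W => ?_⟩
  by_cases hW : W = ⊥
  · exact Or.inl hW
  right
  -- `Γ_F`-stable non-zero subspaces of `W`, and one of minimal dimension
  let S : Set (Submodule A (Fin (d * m) → A)) := fun U =>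
    U ≤ W.toSubmodule ∧ U ≠ ⊥ ∧ ∀ σ : absoluteGaloisGroup F, ∀ u ∈ U, M (absGaloisRestrict K F σ) *ᵥ u ∈ U
  have hWS : W.toSubmodule ∈ S := by
    refine ⟨le_rfl, fun h => hW (Subrepresentation.toSubmodule_injective (h.trans rfl)), ?_⟩
    intro σ u hu
    rw [← hact]
    exact W.apply_mem_toSubmodule _ hu
  have hex : ∃ k, ∃ U ∈ S, Module.finrank A U = k := ⟨_, _, hWS, rfl⟩
  obtain ⟨U, hUS, hUk⟩ := Nat.find_spec hex
  have hUmin : ∀ U' ∈ S, U' ≤ U → U' = U := by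
    intro U' hU'S hle
    apply Submodule.eq_of_le_of_finrank_eq hle
    apply le_antisymm (Submodule.finrank_mono hle)
    rw [hUk]
    exact Nat.find_min' hex ⟨U', hU'S, rfl⟩
  obtain ⟨hUW, hU0, hUstab⟩ := hUS
  -- a non-zero vector of `U` and a block where it is visible
  obtain ⟨u, huU, hu0⟩ := (Submodule.ne_bot_iff U).1 hU0
  obtain ⟨i, hi⟩ : ∃ i, proj i u ≠ 0 := by
    by_contra hcon
    rw [not_exists] at hcon
    simp only [not_not] at hcon
    apply hu0
    rw [hrecon ⟨0, hdpos⟩ u fun j _ => hcon j, hcon ⟨0, hdpos⟩]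
    funext x
    obtain ⟨⟨j, a⟩, rfl⟩ := finProdFinEquiv.surjective x
    rw [hemb, Pi.zero_apply, Pi.zero_apply, ite_self]
  -- on `U`, a projection is either zero or injective with image everything
  have hdich : ∀ j, (∃ u' ∈ U, proj j u' ≠ 0) →
      (∀ u' ∈ U, proj j u' = 0 → u' = 0) ∧ U.map (proj j) = ⊤ := by
    intro j hj
    constructor
    · -- the kernel `U ⊓ ker (proj j)` is stable and proper, hence zero
      intro u' hu' hpu'
      by_contra hne
      have hKS : U ⊓ LinearMap.ker (proj j) ∈ S := by
        refine ⟨inf_le_left.trans hUW, ?_, ?_⟩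
        · rw [Submodule.ne_bot_iff]
          exact ⟨u', ⟨hu', LinearMap.mem_ker.2 hpu'⟩, hne⟩
        · intro σ x hx
          refine ⟨hUstab σ x hx.1, LinearMap.mem_ker.2 ?_⟩
          rw [hequiv, LinearMap.mem_ker.1 hx.2, Matrix.mulVec_zero]
      have hK := hUmin _ hKS inf_le_left
      obtain ⟨u'', hu'', hpu''⟩ := hj
      have : u'' ∈ U ⊓ LinearMap.ker (proj j) := hK.symm ▸ hu''
      exact hpu'' (LinearMap.mem_ker.1 this.2)
    · refine hCirr j _ (fun σ v hv => ?_) ?_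
      · obtain ⟨x, hx, rfl⟩ := Submodule.mem_map.1 hv
        exact Submodule.mem_map.2 ⟨_, hUstab σ x hx, hequiv j σ x⟩
      · rw [Submodule.ne_bot_iff]
        obtain ⟨u'', hu'', hpu''⟩ := hj
        exact ⟨_, Submodule.mem_map.2 ⟨u'', hu'', rfl⟩, hpu''⟩
  obtain ⟨hinj_i, hsurj_i⟩ := hdich i ⟨u, huU, hi⟩
  -- every other projection vanishes on `U` (non-conjugacy of the conjugates)
  have hvan : ∀ j, j ≠ i → ∀ u' ∈ U, proj j u' = 0 := by
    intro j hji u' hu'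
    by_contra hne
    obtain ⟨hinj_j, hsurj_j⟩ := hdich j ⟨u', hu', hne⟩
    -- the two isomorphisms `U ≅ A^m`
    have hbij : ∀ k, (∀ x ∈ U, proj k x = 0 → x = 0) → U.map (proj k) = ⊤ →
        Function.Bijective ((proj k).domRestrict U) := by
      intro k hinjk hsurjk
      constructor
      · intro x y hxy
        apply Subtype.ext
        have := hinjk (x - y) (U.sub_mem x.2 y.2) (by
          rw [map_sub, sub_eq_zero]; exact hxy)
        exact sub_eq_zero.1 this
      · intro v
        have hv : v ∈ U.map (proj k) := hsurjk ▸ Submodule.mem_top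
        obtain ⟨x, hx, rfl⟩ := Submodule.mem_map.1 hv
        exact ⟨⟨x, hx⟩, rfl⟩
    let Pi : U ≃ₗ[A] (Fin m → A) := LinearEquiv.ofBijective _ (hbij i hinj_i hsurj_i)
    let Pj : U ≃ₗ[A] (Fin m → A) := LinearEquiv.ofBijective _ (hbij j hinj_j hsurj_j)
    have hPi : ∀ x : U, Pi x = proj i x := fun x => rfl
    have hPj : ∀ x : U, Pj x = proj j x := fun x => rfl
    let T : (Fin m → A) ≃ₗ[A] (Fin m → A) := Pi.symm.trans Pj
    -- `T` intertwines `C i` and `C j`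
    have hT : ∀ (σ : absoluteGaloisGroup F) (v : Fin m → A), T (C i σ *ᵥ v) = C j σ *ᵥ T v := by
      intro σ v
      obtain ⟨x, rfl⟩ := Pi.surjective v
      have hx' : M (absGaloisRestrict K F σ) *ᵥ (x : Fin (d * m) → A) ∈ U := hUstab σ x x.2
      have h1 : C i σ *ᵥ Pi x = Pi ⟨_, hx'⟩ := by rw [hPi, hPi, hequiv]
      rw [h1]
      change Pj (Pi.symm (Pi _)) = C j σ *ᵥ Pj (Pi.symm (Pi x))
      rw [LinearEquiv.symm_apply_apply, LinearEquiv.symm_apply_apply, hPj, hPj]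
      exact hequiv j σ x
    -- as matrices: `Q (C i σ) = (C j σ) Q`, `Q` invertible
    have hTid : (T : (Fin m → A) →ₗ[A] (Fin m → A)) ∘ₗ (T.symm : (Fin m → A) →ₗ[A] (Fin m → A)) =
        LinearMap.id := LinearMap.ext fun v => T.apply_symm_apply v
    have hTid' : (T.symm : (Fin m → A) →ₗ[A] (Fin m → A)) ∘ₗ (T : (Fin m → A) →ₗ[A] (Fin m → A)) =
        LinearMap.id := LinearMap.ext fun v => T.symm_apply_apply v
    let Q : GL (Fin m) A :=
      ⟨LinearMap.toMatrix' (T : (Fin m → A) →ₗ[A] (Fin m → A)),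
        LinearMap.toMatrix' (T.symm : (Fin m → A) →ₗ[A] (Fin m → A)),
        by rw [← LinearMap.toMatrix'_comp, hTid, LinearMap.toMatrix'_id],
        by rw [← LinearMap.toMatrix'_comp, hTid', LinearMap.toMatrix'_id]⟩
    have hQ : ∀ σ, (Q : Matrix (Fin m) (Fin m) A) * C i σ = C j σ * (Q : Matrix (Fin m) (Fin m) A) := by
      intro σ
      have h : (T : (Fin m → A) →ₗ[A] (Fin m → A)) ∘ₗ Matrix.toLin' (C i σ) =
          Matrix.toLin' (C j σ) ∘ₗ (T : (Fin m → A) →ₗ[A] (Fin m → A)) :=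
        LinearMap.ext fun v => by
          rw [LinearMap.comp_apply, LinearMap.comp_apply, Matrix.toLin'_apply, Matrix.toLin'_apply]
          exact hT σ v
      have h' := congrArg LinearMap.toMatrix' h
      rw [LinearMap.toMatrix'_comp, LinearMap.toMatrix'_comp, LinearMap.toMatrix'_toLin',
        LinearMap.toMatrix'_toLin'] at h'
      exact h'
    refine hreg i j (Ne.symm hji) Q (ContinuousMonoidHom.ext fun σ => Units.ext ?_)
    rw [FramedRep.conj_apply, Units.val_mul, Units.val_mul]
    show C j σ = (Q : Matrix (Fin m) (Fin m) A) * C i σ * ((Q⁻¹ : GL (Fin m) A) : Matrix (Fin m) (Fin m) A)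
    rw [hQ σ, mul_assoc, ← Units.val_mul, mul_inv_cancel, Units.val_one, mul_one]
  -- hence `U` is the full block `V_i`, inside `W`
  have hblock : ∀ v : Fin m → A, emb i v ∈ W.toSubmodule := by
    intro v
    have hv : v ∈ U.map (proj i) := hsurj_i ▸ Submodule.mem_top
    obtain ⟨x, hx, rfl⟩ := Submodule.mem_map.1 hv
    rw [← hrecon i x fun j hji => hvan j hji x hx]
    exact hUW hx
  -- every block lies in `W`, and the blocks span
  have hall : ∀ k (v : Fin m → A), emb k v ∈ W.toSubmodule := by
    intro k v
    have := W.apply_mem_toSubmodule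
      (absGaloisCosetRep K F hd k * (absGaloisCosetRep K F hd i)⁻¹) (hblock v)
    rwa [hact, htrans] at this
  apply Subrepresentation.toSubmodule_injective
  change W.toSubmodule = ⊤
  rw [eq_top_iff]
  rintro w -
  rw [hsum w]
  exact W.toSubmodule.sum_mem fun k _ => hall k _

end Main

end Summit.Langlands.Langlands.Theorems.IrreducibleOffSector

end
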